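import Summits.CriticalPhenomena.Ising3DConformalLimit.Theses.HarmonicMomentsIsotropy
import HarnessLib

/-!
# Crux `HarmonicMomentsIsotropy.RotationUpgrade` (stmt-CriticalPhenomena-6033) — birth skeleton, line `birth`

Registered by `planner-skel-stmt-CriticalPhenomena-6033-0` (skeleton-register one-shot, 2026-08-17) for route
`route-CriticalPhenomena-HarmonicMomentsIsotropy` (sub-problem `Ising3DConformalLimit`).

## The crux

`RotationUpgrade` : (H_lat) vague asymptotic `O(3)`-isotropy of the critical lattice two-point function
`⟨σ₀σ_x⟩_{β_c}` on `ℤ³` against rescaled test functions (the text of the route's milestone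
`TwoPointAsymptoticIsotropy`, item 6036) `→` for every `(ρ, Δ, S)` with (H1) `ρ > 0` on `(0,1]`,
(H2) `HasPointwiseScalingLimit (criticalCorr 3) ρ S`, (H3) `S = 0` off `NonCoincident`, (H4) `IsNondegenerateTwoPoint S`,
(H5) `IsTranslationInvariant S`, (H6) `IsScaleCovariant Δ S`: `IsRotationInvariant S` (all orders, all of `O(3)`).

## The line (= the route's own two-layer plan "RotationUpgrade ⇐ LatticeToLimitIsotropy → NPointHarmonicFlow")

* STUB 1 `stub_latticeToLimitTwoPointIsotropy` (the `n = 2` step, lattice → limit): under (H_lat), the two-point KERNEL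
  `x ↦ S 2 ![0, x]` of every limit `S` satisfying (H1)–(H6) is invariant under every linear isometry of `ℝ³` off the origin.
  Route mechanism: Riemann sums of the rescaled correlator against `φ ∘ R` and `φ` (test functions supported away from `0`,
  where (H2) converges locally uniformly), the dictionary `Matrix.orthogonalGroup (Fin 3) ℝ ↔ (E³ ≃ₗᵢ[ℝ] E³)`, then
  "equal against all non-negative test functions + `ContinuousOn K {0}ᶜ` (landed `twoPointKernelOfLimit_proof`, item 1983)
  ⇒ pointwise equality".  STATUS IN TREE: dischargeable OUTRIGHT (even without H_lat) by the landed milestone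
  `Summit.CriticalPhenomena.Ising3DConformalLimit.HyperoctahedralRPTwoPoint.twoPointLimitIsotropic_proof`
  (item stmt-1984, `Theorems/HyperoctahedralRPTwoPointLimitIsotropicHolds.lean`; ledger: closed/proved 2026-08-16):
  `fun _ ρ Δ S hρ hlim _ hnd htr hsc => twoPointLimitIsotropic_proof ρ Δ S hρ hlim hnd htr hsc`.
* STUB 2 `stub_nPointUpgradeFromTwoPoint` (the `n ≥ 3` step): (H1)–(H6) + two-point kernel isotropy off `0` ⇒
  `IsRotationInvariant S`.  This is VERBATIM the signature of crux `GaussianScaleMixture.RotationUpgradeFromTwoPoint`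
  (item stmt-8367), which the ledger shows closed/proved (2026-08-16T22:36Z) by
  `Summit.CriticalPhenomena.Ising3DConformalLimit.Cruxes.RotationUpgradeFromTwoPoint.NullLaplacianEdgeGaussianity.rotationUpgradeFromTwoPoint_proof`
  (`Theorems/GaussianScaleMixtureRotationUpgradeFromTwoPoint.lean`: Gaussian locus by Wick / Aizenman–Newman; edge `Δ = 1/2`
  excluded by the OS null vector + Bôcher–Liouville; interior by the multiple-reflection unit sigma bound + the
  quarter-turn/periodic-Liouville graft of line `quarter-turn-liouville` of crux stmt-1980): `exact rotationUpgradeFromTwoPoint_proof`.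
* COMPOSITION `RotationUpgrade_of : RotationUpgrade` — the registered A12 skeleton theorem: concludes the route decl BY
  NAME with no hypotheses, its proof being the real two-line composition of STUB 1 and STUB 2 (no `sorry` of its own;
  `sorryAx` reaches it only through the stubs).  The same composition in arrow form `STUB-1-sig → STUB-2-sig →
  RotationUpgrade` is kernel-checked as a closing `example` (sorry-free, standard axioms).

Consequence for the lead: with items 1984 and 8367 landed, this crux should close in ONE cycle — import
`…Theorems.HyperoctahedralRPTwoPointLimitIsotropicHolds` and `…Theorems.GaussianScaleMixtureRotationUpgradeFromTwoPoint`,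
discharge both stubs by the two displayed terms, and `RotationUpgrade_of` is the route decl.  (The registrar does not prove;
this file deliberately imports neither Theorems module so that the stubs stay honest `sorry`s and the BC3 probes run in the
bare route context.)

## Hardest stub

Mathematically STUB 2 (XL: the `n ≥ 3` upgrade; no engine in print before the tree's own 8367 line).  As WORK REMAINING in
this tree: none beyond citation, see above; if the 8367 import were unavailable, STUB 1 via the route's own Riemann-sum glue is
size M and STUB 2 is the whole difficulty.

## Disproof used

No `Disproof.lean` exists for this crux (`ledger crux ls stmt-CriticalPhenomena-6033`: no workfiles at registration) and no
`Theorems/RotationUpgrade/Negative/` lemma is landed.  Nearest negative knowledge, honoured: (i) the coincident-locus junk of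
`Theorems/IsingEuclidUpgradeRefutations.lean` — both stubs carry the normalisation hypothesis (H3) of the crux verbatim;
(ii) `Theorems/RotationUpgradeFromTwoPoint/Negative/AutomaticOrders.lean` (sibling crux 8367: orders `0`, odd, `2` are
automatic, the content is `S₄, S₆, …`; (H5), (H6) redundant given (H1)–(H4)) — consistent with the cut: STUB 1 is exactly the
order-2 input, STUB 2 the even orders `≥ 4`; (iii) the refuter's route-review note on 6033 (2026-08-15): "cannot be refuted
model-blindly; any proof must use Ising structure" — STUB 2 keeps (H2) (the Ising scaling-limit hypothesis) load-bearing.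

## BC3 audit (planner's folder, 2026-08-17; raw outputs in the seat's NOTES.md `birth-certificate:`)

`lean check --json birth.lean`: rc 0, errors [], sorries = 2 = #stubs (the `declaration uses sorry` warnings sit at
`stub_latticeToLimitTwoPointIsotropy` and `stub_nPointUpgradeFromTwoPoint` only), zero elsewhere: `RotationUpgrade_of`
has no `sorry` of its own (its axiom closure is [propext, Classical.choice, Quot.sound, sorryAx] with `sorryAx` entering
only through the two stub constants; the arrow-form `example` closes under [propext, Classical.choice, Quot.sound]);
`RotationUpgrade_of` concludes `Summit.CriticalPhenomena.Ising3DConformalLimit.Theses.HarmonicMomentsIsotropy.RotationUpgrade`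
by name; `ledger skeleton check … --crux stmt-CriticalPhenomena-6033` registers stubs
`stub_latticeToLimitTwoPointIsotropy`, `stub_nPointUpgradeFromTwoPoint`.  Probes (`bc/RotationUpgrade_birth_probes_v2.lean`
in the seat folder, same imports as this file): `stub → RotationUpgrade` and `stub → Ising3DConformalLimit` for both
stubs, each with six tactics in separate examples (`exact?`, `simpa`, `aesop`, `simpa [defs]`, `unfold; exact?`,
`unfold; aesop`): 24/24 FAIL (see `Lines/birth.md`).
-/

namespace Summit.CriticalPhenomena.Ising3DConformalLimit.Cruxes.RotationUpgrade.Birth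

/-- STUB 1 (`n = 2`, lattice → limit).  Under the vague asymptotic `O(3)`-isotropy of `⟨σ₀σ_x⟩_{β_c}` on `ℤ³` (H_lat), the
two-point kernel `x ↦ S 2 ![0, x]` of every normalised, non-degenerate, translation-invariant, scale-covariant pointwise
scaling limit `S` of `criticalCorr 3` is invariant under all linear isometries off the origin.  Why plausibly true: Riemann
sums + local uniform convergence off the diagonal + continuity of the kernel off `0` (Messager–Miracle-Solé, landed item
1983); in fact a THEOREM of the tree without (H_lat): `HyperoctahedralRPTwoPoint.twoPointLimitIsotropic_proof` (item 1984).
Size: M (citation: XS). -/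
theorem stub_latticeToLimitTwoPointIsotropy :
    (∀ (φ : (Fin 3 → ℝ) → ℝ), Continuous φ → HasCompactSupport φ → (∀ v, 0 ≤ φ v) → (∃ v, 0 < φ v) →
      ∀ R : Matrix.orthogonalGroup (Fin 3) ℝ, Filter.Tendsto (fun L : ℝ =>
        (∑' x : Literature.Probability.LatticeModels.Site 3,
            φ (L⁻¹ • (R.1.mulVec (fun i => (x i : ℝ)))) * Literature.Probability.LatticeModels.criticalTwoPoint 3 x) /
        (∑' x : Literature.Probability.LatticeModels.Site 3,
            φ (L⁻¹ • (fun i => (x i : ℝ))) * Literature.Probability.LatticeModels.criticalTwoPoint 3 x))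
        Filter.atTop (nhds 1)) →
    ∀ (ρ : ℝ → ℝ) (Δ : ℝ) (S : Literature.Probability.LatticeModels.CorrFamily 3),
      (∀ δ ∈ Set.Ioc (0:ℝ) 1, 0 < ρ δ) →
      Literature.Probability.LatticeModels.HasPointwiseScalingLimit
        (Literature.Probability.LatticeModels.criticalCorr 3) ρ S →
      (∀ n z, z ∉ Literature.Probability.LatticeModels.NonCoincident 3 n → S n z = 0) →
      Literature.Probability.LatticeModels.IsNondegenerateTwoPoint S →
      Literature.Probability.LatticeModels.IsTranslationInvariant S →
      Literature.Probability.LatticeModels.IsScaleCovariant Δ S →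
      ∀ (R : EuclideanSpace ℝ (Fin 3) ≃ₗᵢ[ℝ] EuclideanSpace ℝ (Fin 3)) (x : EuclideanSpace ℝ (Fin 3)),
        x ≠ 0 → S 2 ![0, R x] = S 2 ![0, x] := by
  sorry

/-- STUB 2 (`n ≥ 3`, the n-point upgrade).  Every normalised, non-degenerate, translation-invariant, scale-covariant
pointwise scaling limit `S` of `criticalCorr 3` whose two-point kernel is isometry-invariant off `0` is `IsRotationInvariant`
(all orders, `O(3)` incl. reflections).  Verbatim the signature of crux `GaussianScaleMixture.RotationUpgradeFromTwoPoint`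
(item stmt-8367, closed/proved): discharge by
`Cruxes.RotationUpgradeFromTwoPoint.NullLaplacianEdgeGaussianity.rotationUpgradeFromTwoPoint_proof`.  Why plausibly true:
it is a theorem of the tree (nine-mirror OS positivity of the Ising limit + unit sigma bound + quarter-turn Liouville).
Size: XL as mathematics (citation: XS). -/
theorem stub_nPointUpgradeFromTwoPoint :
    ∀ (ρ : ℝ → ℝ) (Δ : ℝ) (S : Literature.Probability.LatticeModels.CorrFamily 3),
      (∀ δ ∈ Set.Ioc (0:ℝ) 1, 0 < ρ δ) →
      Literature.Probability.LatticeModels.HasPointwiseScalingLimit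
        (Literature.Probability.LatticeModels.criticalCorr 3) ρ S →
      (∀ n z, z ∉ Literature.Probability.LatticeModels.NonCoincident 3 n → S n z = 0) →
      Literature.Probability.LatticeModels.IsNondegenerateTwoPoint S →
      Literature.Probability.LatticeModels.IsTranslationInvariant S →
      Literature.Probability.LatticeModels.IsScaleCovariant Δ S →
      (∀ (R : EuclideanSpace ℝ (Fin 3) ≃ₗᵢ[ℝ] EuclideanSpace ℝ (Fin 3)) (x : EuclideanSpace ℝ (Fin 3)),
        x ≠ 0 → S 2 ![0, R x] = S 2 ![0, x]) →
      Literature.Probability.LatticeModels.IsRotationInvariant S := by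
  sorry

/-- REGISTERED COMPOSITION (the A12 skeleton theorem): concludes the route decl `RotationUpgrade` BY NAME, with NO
hypotheses; its proof is the real composition of the two declared stubs (no `sorry` of its own — `sorryAx` enters only
through `stub_*`, so the day both stubs are theorems this declaration IS the crux proof).  Given (H_lat) and a limit
`(ρ, Δ, S)` with (H1)–(H6), STUB 1 supplies two-point kernel isotropy, STUB 2 upgrades it to all orders. -/
theorem RotationUpgrade_of :
    Summit.CriticalPhenomena.Ising3DConformalLimit.Theses.HarmonicMomentsIsotropy.RotationUpgrade := by
  -- `RotationUpgrade` is the route `def`; expose its binders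
  unfold Summit.CriticalPhenomena.Ising3DConformalLimit.Theses.HarmonicMomentsIsotropy.RotationUpgrade
  intro hlat ρ Δ S hρ hlim hnorm hnd htr hsc
  exact stub_nPointUpgradeFromTwoPoint ρ Δ S hρ hlim hnorm hnd htr hsc
    (stub_latticeToLimitTwoPointIsotropy hlat ρ Δ S hρ hlim hnorm hnd htr hsc)

/- COMPOSITION IN ARROW FORM (BC3 shape `stub₁-sig → stub₂-sig → C`, kernel-checked, sorry-free, closed under
[propext, Classical.choice, Quot.sound]): stated as an `example` so that exactly ONE constant of this file concludes the
crux by name (the registered `RotationUpgrade_of` above). -/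
example :
    ((∀ (φ : (Fin 3 → ℝ) → ℝ), Continuous φ → HasCompactSupport φ → (∀ v, 0 ≤ φ v) → (∃ v, 0 < φ v) →
      ∀ R : Matrix.orthogonalGroup (Fin 3) ℝ, Filter.Tendsto (fun L : ℝ =>
        (∑' x : Literature.Probability.LatticeModels.Site 3,
            φ (L⁻¹ • (R.1.mulVec (fun i => (x i : ℝ)))) * Literature.Probability.LatticeModels.criticalTwoPoint 3 x) /
        (∑' x : Literature.Probability.LatticeModels.Site 3,
            φ (L⁻¹ • (fun i => (x i : ℝ))) * Literature.Probability.LatticeModels.criticalTwoPoint 3 x))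
        Filter.atTop (nhds 1)) →
    ∀ (ρ : ℝ → ℝ) (Δ : ℝ) (S : Literature.Probability.LatticeModels.CorrFamily 3),
      (∀ δ ∈ Set.Ioc (0:ℝ) 1, 0 < ρ δ) →
      Literature.Probability.LatticeModels.HasPointwiseScalingLimit
        (Literature.Probability.LatticeModels.criticalCorr 3) ρ S →
      (∀ n z, z ∉ Literature.Probability.LatticeModels.NonCoincident 3 n → S n z = 0) →
      Literature.Probability.LatticeModels.IsNondegenerateTwoPoint S →
      Literature.Probability.LatticeModels.IsTranslationInvariant S →
      Literature.Probability.LatticeModels.IsScaleCovariant Δ S →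
      ∀ (R : EuclideanSpace ℝ (Fin 3) ≃ₗᵢ[ℝ] EuclideanSpace ℝ (Fin 3)) (x : EuclideanSpace ℝ (Fin 3)),
        x ≠ 0 → S 2 ![0, R x] = S 2 ![0, x]) →
    (∀ (ρ : ℝ → ℝ) (Δ : ℝ) (S : Literature.Probability.LatticeModels.CorrFamily 3),
      (∀ δ ∈ Set.Ioc (0:ℝ) 1, 0 < ρ δ) →
      Literature.Probability.LatticeModels.HasPointwiseScalingLimit
        (Literature.Probability.LatticeModels.criticalCorr 3) ρ S →
      (∀ n z, z ∉ Literature.Probability.LatticeModels.NonCoincident 3 n → S n z = 0) →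
      Literature.Probability.LatticeModels.IsNondegenerateTwoPoint S →
      Literature.Probability.LatticeModels.IsTranslationInvariant S →
      Literature.Probability.LatticeModels.IsScaleCovariant Δ S →
      (∀ (R : EuclideanSpace ℝ (Fin 3) ≃ₗᵢ[ℝ] EuclideanSpace ℝ (Fin 3)) (x : EuclideanSpace ℝ (Fin 3)),
        x ≠ 0 → S 2 ![0, R x] = S 2 ![0, x]) →
      Literature.Probability.LatticeModels.IsRotationInvariant S) →
    Summit.CriticalPhenomena.Ising3DConformalLimit.Theses.HarmonicMomentsIsotropy.RotationUpgrade := by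
  intro h1 h2
  -- `RotationUpgrade` is the route `def`; expose its binders
  unfold Summit.CriticalPhenomena.Ising3DConformalLimit.Theses.HarmonicMomentsIsotropy.RotationUpgrade
  intro hlat ρ Δ S hρ hlim hnorm hnd htr hsc
  exact h2 ρ Δ S hρ hlim hnorm hnd htr hsc (h1 hlat ρ Δ S hρ hlim hnorm hnd htr hsc)

end Summit.CriticalPhenomena.Ising3DConformalLimit.Cruxes.RotationUpgrade.Birth
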